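import Literature.MathematicalPhysics.QuantumFieldTheory.Balaban1983to89.T4AxialGaugeSmallField

/-!
# `T4Continuum.ShellMeasureSlotDimension` — audit γ15 «THE DIMENSION SUMMAND `m₀` OF THE SLOT CONSTANT»: the chart pins
# `m₀ = 3·#Λ`; a chart in a side-`M` box of its OWN lattice has `m₀ ≤ 3·d·(M+1)^d`; the `m₀`-summand of the ONE CALL's `hDslot`
# is met by a LEVEL profile (by ONE real under a DISPLAYED cap of the coupling-dependent side profile); numbers
(cell `pub-balaban`, sub-cell `t4`, spine estimate NE7c (node U5b); NE7c ROUND-2 crew, unit `b2b-balaban-t4-ne7c-formalise-leaf-09`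
gen 13; owner table `t4/b2b-balaban-t4-ne7c-p1/LEAVES-NE7c-P1.md` row **S101** «THE DIMENSION SUMMAND `m₀` OF THE SLOT CONSTANT IN
KERNEL» — GO R-ne7cp1-g35-2 (c) on this seat's OFFER (owner g34's lens γ15 of `gen34/handoff_g34.md`: «`hDslot`'s `m₀` term: confirm
`m₀ = 3·#Λ` counts UNIT-lattice bonds (level-free polylog) in S80 f6's reading, not fine bonds»); ADDITIVE — imports
`T4AxialGaugeSmallField` ONLY (`castSite`, `boxBonds`, `castSite_injOn_box`); [folklore]; 0 `def`, 0 `def … : Prop`, 0 sorry,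
0 citation tags)

HONEST FRAMING.  Finite four-torus programme, rung (B)+1 only — NOT infinite volume, NOT a mass gap, NOT the Clay problem, NOT
summit progress; (B), `BetaPertHyp`, (B^μ) not consumed.  NE7c (`T4IndicatorShell.ShellWeightBound` for the cell's expansions) is
NOT PRINTED in [Balaban 1983–89] and NOT PROVED; «NE7c ⇐ the named binders» (trigger c3).  This file is ARITHMETIC ON OUR OWN
BINDER SHAPES — the chart equivalence `e : ↥Λ × Fin 3 ≃ Fin m₀` and the box hypothesis `Λ ⊆ boxBonds lo hi` of the END hosts
(S76 f2 `ShellMeasureLandauEndFinal`, S80 f3 `ShellMeasureLandauEndRayStokesAssembledDecay`, S80 f6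
`ShellMeasureLandauEndAssembledDecayReachBox`) and of the ONE CALL of record (S95 f3′ `ShellMeasureLiveEndOneCallUnionLevels`,
`m₀ : Bool → ℕ → σ₁ → ℕ`); nothing of Bałaban's is asserted, cited or discharged.  HONEST DEPENDENCY (cell): continuum YM on T⁴ ⇐
BetaPertH ∧ nine spine estimates (0/9 proved); BetaPertH ⇐ (D1) ∧ (D4) ∧ CAP+tail; G-an2-4 gates asym, D1 and NE2/3/4.

THE POINT (γ15).  The slot constant of every END host is `2(m₀ + …)∕(1 − δ)` with `m₀` the real dimension of the chart
`E ≃ (Fin m₀ → ℝ)` (the ray-weight loss of the one-depth engine `ShellMeasureScalingLocal.slotAntiConcentration_of_coreMap_mul`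
is `dim E · ρ`).  In the ONE CALL the dimension is ALREADY SLOT-INDEXED (`m₀ r K s`) and enters only the left side of the
slot→level majorant `hDslot : 2(m₀ r K s + …)∕(1−δ) ≤ D r (lvl r K s)`, next to the level-free cap `hDbar : D r j ≤ D̄` (owner census
`ONECALL-CENSUS-NE7c.md` rows R01 ∕ R23a).  So WALL §2b's LIFT RULE is moot for `m₀`; what decides inhabitability of `hDslot` ∧ `hDbar`
is the SIZE of `#Λ` as a function of the slot's level:
* §1 `m₀_eq_three_mul_card` — the chart PINS it: `m₀ = 3·#Λ` (`Fintype.card_congr e`).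
* §2 `card_le_of_subset_boxBonds` — `Λ ⊂ PBond P j` lives in ONE lattice `T^{(j)}` (the slot's field is `GaugeField P j SU2`); if it
  sits in the box `[lo, hi]` of that lattice (S80 f6's `hΛbox`; S89∕S96 toys) then `#Λ ≤ d·∏_κ (hi κ + 1 − lo κ)` — the image of a
  finite index set, NO non-wrapping needed; on a box of side `M` (`hi = lo + M`): `#Λ ≤ d(M+1)^d` and **`m₀ ≤ 3d(M+1)^d`**
  (`card_le_of_side`, `m₀_le_of_box`).
* §2b `card_boxBonds_eq` ∕ `card_boxBonds_side` — on a NON-WRAPPING box (`hi κ − lo κ < sitesPerDir j`, `castSite` injective)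
  the exact count `#boxBonds = Σ_μ ∏_κ (hi κ − (e_μ)_κ + 1 − lo κ)`, `= d·M·(M+1)^{d−1}` on a cube of side `M`; so any block
  `box ∖ comb ⊆ Λ ⊆ box` has `d·M·(M+1)^{d−1} − #comb ≤ #Λ ≤ d·M·(M+1)^{d−1}` (the axial comb is a spanning tree of the
  `(M+1)^d` box sites, `#comb = (M+1)^d − 1` — NOT kernel-checked here).
* §3 THE ONE-CALL SHAPE: for slot families `(r, K, s)` charted in boxes of side `Ms r (lvl r K s)` of their own lattice,
  `(m₀ r K s : ℝ) ≤ 3·d·(Ms r (lvl r K s) + 1)^d` (`hDslot_dim_of_box`) — the `m₀`-summand of `hDslot` is met by a LEVEL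
  profile; under a DISPLAYED cap of that profile `Ms r j ≤ M̄` it is met by ONE real (`hDbar_dim_of_box`) — the `m₀` part of
  `hDbar`; the junction into S95's literal `hDslot`∕`hDbar` shapes is the arithmetic `hDslot_of_levelProfiles` ∕ `hDbar_of_caps`.
  THE SIDE PROFILE IS COUPLING-DEPENDENT (owner R-ne7cp1-g35-2 (c), the sentence this row owes): in the designed reading the
  box is the classifier's cube of [Balaban1988Convergent] p. 257 (2.17), of side `L·M₂·R_j`-TYPE in the slot's unit lattice, with
  `R_j` the smallest power `L^r ≥ (log g_j^{−2})^{p}` of p. 255 (2.5) — a function of the running coupling `g_j`; so `Ms r j` is a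
  genuine LEVEL PROFILE and the cap `M̄` of `hDbar_dim_of_box` is NOT a constant of `d, L` alone: it is inhabited on the LIVE
  WINDOW `K − N₁ ≤ j ≤ K` under the IR pin of the couplings (WALL `t4/b2b-balaban-t4-ne7c-p1/WALL-NE7c-P1.md` COUPLING paragraph:
  at the live levels `g_j` ranges over the couplings of the last `N₁ + 1` physical scales, uniformly in `K`), and is DISPLAYED
  as the hypothesis `hMs`, asserted by nobody — exactly WALL §2b's «K-uniform up to the polylog `R_j`».
* §4 NUMBERS (`norm_num`): the one-bond toys S88∕S96: `m₀ = 3`; S89's side-2 box on `toyParams` (`d = 2`, 3 sites per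
  direction): `#box = 12`, cap `#Λ ≤ 18`, designed block `12 − 8 = 4` bonds, `m₀ = 12`; `d = 4`: cap `m₀ ≤ 12(M+1)^4` — side `2`:
  `#box = 216`, cap `m₀ ≤ 972`, designed block `216 − 80 = 136` bonds, `m₀ = 408`; side `13` (print's smallest odd `L > 11`,
  [Balaban1987RG1] p. 251 — DIVERGENCE F1 — times `M₂R_j ≥ 1`): `#box = 142 688`, cap `m₀ ≤ 12·14^4 = 460 992`, designed block
  `142 688 − 38 415 = 104 273` bonds, `m₀ = 312 819`.  CONSEQUENCE STATED AS A NUMBER (not proved, not this node's: trigger c4):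
  the slot constant `D_j ≥ 2m₀∕(1−δ)` is `≥ 816` on a side-2 box at `d = 4` and `≥ 625 638` at side `13`, so (M1) at such a live
  slot is NON-VACUOUS (`D_j·ρ_j < 1`, referee pass 22 F-ne7cleaf04g8-1) only for a relative two-run closeness `ρ_j < 1.3·10⁻³`
  resp. `< 1.6·10⁻⁶` — a DEMAND on row U1b's rate, consumed BY NAME in the ONE CALL (`hrate`), growing like the fourth power of
  the coupling-dependent block side.
READING (locators for a READING of printed structure — NOT citations, nothing asserted): [Balaban1988Convergent] p. 257
(2.16)–(2.17): the classifier's cubes `□` partition «the lattice `T_η` into cubes of the size `L M₂ R_k`», sizes in units of the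
step's UNIT lattice; p. 258 (2.20)–(2.21): «the operation `T^{(j)}` involves integration with respect to the gauge field variables
`V_j` on `Ω_{j+1} ∩ X`» — `V_j` lives on `T^{(j)}` (`Setup.Site P j`, `2L^{m+K−j}` sites per direction), so a level-`j` slot's
integrated chart bonds are UNIT-lattice bonds of `T^{(j)}` inside one such cube: `#Λ ≤ d(L M₂ R_j + 1)^d`, `R_j` the
coupling-dependent polylog of p. 255 (2.5) (above) — capped on the live window under the IR pin, not absolutely.
The FINE misreading (`jl := 0`, `Λ` = the `η_j`-bonds inside `□`, `#Λ ∝ (L M₂ R_j L^{j})^d`) would make `hDbar` uninhabitable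
jointly with `hDslot` (a fourth instance of F-ne7cp1-g34-1 (b)); it is NOT the reading of any END host (S80 f6's box and the toys
chart the slot's own lattice); where `jl` gets pinned is node O's [dict] rows `hRdict`∕`hudict`.  NOTHING in the countdown moves;
NE7c NOT PROVED; spine PROVED 0∕9.
-/

open Finset

namespace Summit.QuantumFields.BalabanUV.T4Continuum.ShellMeasureSlotDimension

open Literature.MathematicalPhysics.QuantumFieldTheory.Balaban1983to89
open T4AxialGaugeSmallField (castSite boxBonds castSite_injOn_box)
open B7Prop1Explicit (e e_apply)
open B8Lemma1NonAbelian (e_nonneg)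

variable {P : Params} {j : ℕ}

/-! ## §1 The chart pins the dimension: `m₀ = 3·#Λ` -/

/-- **THE CHART PINS THE DIMENSION.**  The END hosts' chart enumeration `e : ↥Λ × Fin 3 ≃ Fin m₀` (three real letters of `su(2)`
per block bond) forces `m₀ = 3·#Λ`; in particular `m₀` is a function of the slot's bond set alone. [folklore] -/
theorem m₀_eq_three_mul_card (Λ : Finset (PBond P j)) {m₀ : ℕ} (e : ↥Λ × Fin 3 ≃ Fin m₀) : m₀ = 3 * Λ.card := by
  have h := Fintype.card_congr e
  rw [Fintype.card_prod, Fintype.card_coe, Fintype.card_fin, Fintype.card_fin] at h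
  omega

/-- the same with `n` real letters per bond (the `SU(N)` hosts use `N² − 1`). [folklore] -/
theorem dim_eq_mul_card (Λ : Finset (PBond P j)) {n m₀ : ℕ} (e : ↥Λ × Fin n ≃ Fin m₀) : m₀ = n * Λ.card := by
  have h := Fintype.card_congr e
  rw [Fintype.card_prod, Fintype.card_coe, Fintype.card_fin, Fintype.card_fin] at h
  rw [← h, mul_comm]

/-! ## §2 A chart in a box of its own lattice: `#Λ ≤ d·∏(hi + 1 − lo)`, `m₀ ≤ 3d(M+1)^d` -/

/-- **BOX COUNT.**  If every bond of `Λ ⊂ PBond P j` is a bond of the box `[lo, hi]` of the SAME torus `T^{(j)}` (S80 f6's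
`hΛbox`), then `#Λ ≤ d·∏_κ (hi κ + 1 − lo κ)`: `Λ` lies in the image of `(x, μ) ↦ ⟨castSite x, μ⟩` over `Icc lo hi × Fin d`.
No non-wrapping hypothesis is needed (an image never has more elements than its index set). [folklore] -/
theorem card_le_of_subset_boxBonds (lo hi : Fin P.d → ℤ) (Λ : Finset (PBond P j)) (hΛ : ∀ b ∈ Λ, b ∈ boxBonds lo hi) :
    Λ.card ≤ P.d * ∏ κ, (hi κ + 1 - lo κ).toNat := by
  classical
  have hsub : Λ ⊆ ((Finset.Icc lo hi) ×ˢ (Finset.univ : Finset (Fin P.d))).image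
      (fun q : (Fin P.d → ℤ) × Fin P.d => (⟨castSite q.1, q.2⟩ : PBond P j)) := by
    intro b hb
    obtain ⟨x, hlo, hhi, hsrc⟩ := hΛ b hb
    refine Finset.mem_image.2 ⟨(x, b.dir), Finset.mem_product.2 ⟨Finset.mem_Icc.2 ⟨hlo, ?_⟩, Finset.mem_univ _⟩, ?_⟩
    · exact (le_add_of_nonneg_right (e_nonneg b.dir)).trans hhi
    · cases b with
      | mk src dir => simp only at hsrc; rw [hsrc]
  calc Λ.card ≤ (((Finset.Icc lo hi) ×ˢ (Finset.univ : Finset (Fin P.d))).image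
          (fun q : (Fin P.d → ℤ) × Fin P.d => (⟨castSite q.1, q.2⟩ : PBond P j))).card := Finset.card_le_card hsub
    _ ≤ ((Finset.Icc lo hi) ×ˢ (Finset.univ : Finset (Fin P.d))).card := Finset.card_image_le
    _ = (∏ κ, (hi κ + 1 - lo κ).toNat) * P.d := by
        rw [Finset.card_product, Pi.card_Icc lo hi, Finset.card_univ, Fintype.card_fin]
        simp only [Int.card_Icc]
    _ = P.d * ∏ κ, (hi κ + 1 - lo κ).toNat := mul_comm _ _

/-- **CUBIC BOX.**  On a box of side `M` (`hi κ = lo κ + M`, i.e. `M + 1` sites per direction): `#Λ ≤ d·(M+1)^d`. [folklore] -/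
theorem card_le_of_side (lo hi : Fin P.d → ℤ) {M : ℕ} (hM : ∀ κ, hi κ = lo κ + M) (Λ : Finset (PBond P j))
    (hΛ : ∀ b ∈ Λ, b ∈ boxBonds lo hi) : Λ.card ≤ P.d * (M + 1) ^ P.d := by
  have h := card_le_of_subset_boxBonds lo hi Λ hΛ
  have hprod : ∏ κ : Fin P.d, (hi κ + 1 - lo κ).toNat = (M + 1) ^ P.d := by
    rw [Finset.prod_eq_pow_card (b := M + 1), Finset.card_univ, Fintype.card_fin]
    intro κ _
    rw [hM κ]
    have : lo κ + (M : ℤ) + 1 - lo κ = ((M + 1 : ℕ) : ℤ) := by push_cast; ring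
    rw [this, Int.toNat_natCast]
  rwa [hprod] at h

/-- **`m₀ ≤ 3d(M+1)^d` ON A SIDE-`M` BOX** — the `m₀`-summand of the slot constant `2(m₀ + …)∕(1−δ)` is bounded by the box side
and the dimension alone. [folklore] -/
theorem m₀_le_of_box (lo hi : Fin P.d → ℤ) {M : ℕ} (hM : ∀ κ, hi κ = lo κ + M) (Λ : Finset (PBond P j))
    (hΛ : ∀ b ∈ Λ, b ∈ boxBonds lo hi) {m₀ : ℕ} (e : ↥Λ × Fin 3 ≃ Fin m₀) : m₀ ≤ 3 * (P.d * (M + 1) ^ P.d) := by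
  rw [m₀_eq_three_mul_card Λ e]
  exact Nat.mul_le_mul_left 3 (card_le_of_side lo hi hM Λ hΛ)

/-- the same in `ℝ` (the currency of `hDslot`). [folklore] -/
theorem m₀_le_of_box_real (lo hi : Fin P.d → ℤ) {M : ℕ} (hM : ∀ κ, hi κ = lo κ + M) (Λ : Finset (PBond P j))
    (hΛ : ∀ b ∈ Λ, b ∈ boxBonds lo hi) {m₀ : ℕ} (e : ↥Λ × Fin 3 ≃ Fin m₀) :
    (m₀ : ℝ) ≤ 3 * (P.d : ℝ) * ((M : ℝ) + 1) ^ P.d := by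
  have h := m₀_le_of_box lo hi hM Λ hΛ e
  have : ((3 * (P.d * (M + 1) ^ P.d) : ℕ) : ℝ) = 3 * (P.d : ℝ) * ((M : ℝ) + 1) ^ P.d := by push_cast; ring
  rw [← this]
  exact_mod_cast h

/-! ## §2b The exact count of a non-wrapping box's bonds: `Σ_μ ∏_κ (hi κ − (e_μ)_κ + 1 − lo κ)` = `d·M·(M+1)^{d−1}` on a cube -/

/-- **EXACT BOX-BOND COUNT (non-wrapping).**  On a box with `hi κ − lo κ < sitesPerDir j` (so that `castSite` is injective on it)
the torus bonds of the box are in bijection with the pairs `(μ, x)`, `lo ≤ x ≤ hi − e_μ`; hence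
`#boxBonds = Σ_μ ∏_κ (hi κ − (e_μ)_κ + 1 − lo κ)`. [folklore] -/
theorem card_boxBonds_eq (lo hi : Fin P.d → ℤ) (hN : ∀ κ, hi κ - lo κ < P.sitesPerDir j) [DecidableEq (PBond P j)]
    [DecidablePred fun b : PBond P j => b ∈ boxBonds lo hi] :
    (Finset.univ.filter fun b : PBond P j => b ∈ boxBonds lo hi).card =
      ∑ μ : Fin P.d, ∏ κ, (hi κ - e μ κ + 1 - lo κ).toNat := by
  classical
  set S : Finset (Σ _ : Fin P.d, (Fin P.d → ℤ)) := (Finset.univ : Finset (Fin P.d)).sigma fun μ => Finset.Icc lo (hi - e μ)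
    with hS
  set g : (Σ _ : Fin P.d, (Fin P.d → ℤ)) → PBond P j := fun q => ⟨castSite q.2, q.1⟩ with hg
  have himage : (Finset.univ.filter fun b : PBond P j => b ∈ boxBonds lo hi) = S.image g := by
    ext b
    simp only [Finset.mem_filter, Finset.mem_univ, true_and, Finset.mem_image, hS, Finset.mem_sigma, Finset.mem_Icc]
    constructor
    · rintro ⟨x, hlo, hhi, hsrc⟩
      refine ⟨⟨b.dir, x⟩, ⟨hlo, le_sub_iff_add_le.2 hhi⟩, ?_⟩
      cases b with
      | mk src dir => simp only at hsrc; rw [hsrc]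
    · rintro ⟨⟨μ, x⟩, ⟨hlo, hhi⟩, rfl⟩
      exact ⟨x, hlo, le_sub_iff_add_le.1 hhi, rfl⟩
  have hinj : Set.InjOn g ↑S := by
    rintro ⟨μ, x⟩ hx ⟨μ', x'⟩ hx' hEq
    simp only [Finset.mem_coe, hS, Finset.mem_sigma, Finset.mem_Icc, Finset.mem_univ, true_and] at hx hx'
    simp only [hg, PBond.mk.injEq] at hEq
    obtain ⟨hc, hμ⟩ := hEq
    subst hμ
    have hxhi : x ≤ hi := hx.2.trans (sub_le_self _ (e_nonneg μ))
    have hxhi' : x' ≤ hi := hx'.2.trans (sub_le_self _ (e_nonneg μ))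
    have := castSite_injOn_box hN hx.1 hxhi hx'.1 hxhi' hc
    subst this
    rfl
  rw [himage, Finset.card_image_of_injOn hinj, hS, Finset.card_sigma]
  refine Finset.sum_congr rfl fun μ _ => ?_
  rw [Pi.card_Icc lo (hi - e μ)]
  refine Finset.prod_congr rfl fun κ _ => ?_
  rw [Int.card_Icc, Pi.sub_apply]

/-- **ON A CUBE OF SIDE `M`** (`hi κ = lo κ + M`, non-wrapping): `#boxBonds = d·M·(M+1)^{d−1}` — with §2's cap `d(M+1)^d` this
brackets `#Λ` for any block `comb-complement ⊆ Λ ⊆ box` between `d·M·(M+1)^{d−1} − #comb` and `d·M·(M+1)^{d−1}`. [folklore] -/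
theorem card_boxBonds_side (lo hi : Fin P.d → ℤ) {M : ℕ} (hM : ∀ κ, hi κ = lo κ + M) (hN : ∀ κ, hi κ - lo κ < P.sitesPerDir j)
    [DecidableEq (PBond P j)] [DecidablePred fun b : PBond P j => b ∈ boxBonds lo hi] :
    (Finset.univ.filter fun b : PBond P j => b ∈ boxBonds lo hi).card = P.d * (M * (M + 1) ^ (P.d - 1)) := by
  classical
  rw [card_boxBonds_eq lo hi hN]
  have hterm : ∀ μ : Fin P.d, ∏ κ, (hi κ - e μ κ + 1 - lo κ).toNat = M * (M + 1) ^ (P.d - 1) := by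
    intro μ
    rw [← Finset.mul_prod_erase Finset.univ _ (Finset.mem_univ μ)]
    have h1 : (hi μ - e μ μ + 1 - lo μ).toNat = M := by
      rw [hM μ, e_apply, if_pos rfl]
      have : lo μ + (M : ℤ) - 1 + 1 - lo μ = (M : ℤ) := by ring
      rw [this, Int.toNat_natCast]
    have h2 : ∏ κ ∈ Finset.univ.erase μ, (hi κ - e μ κ + 1 - lo κ).toNat = (M + 1) ^ (P.d - 1) := by
      rw [Finset.prod_eq_pow_card (b := M + 1), Finset.card_erase_of_mem (Finset.mem_univ μ), Finset.card_univ,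
        Fintype.card_fin]
      intro κ hκ
      rw [hM κ, e_apply, if_neg (Finset.ne_of_mem_erase hκ)]
      have : lo κ + (M : ℤ) - 0 + 1 - lo κ = ((M + 1 : ℕ) : ℤ) := by push_cast; ring
      rw [this, Int.toNat_natCast]
    rw [h1, h2]
  simp only [hterm, Finset.sum_const, Finset.card_univ, Fintype.card_fin, smul_eq_mul]

/-! ## §3 The ONE CALL's shape: the `m₀`-summand of `hDslot` is met by a LEVEL profile -/

section OneCall

variable {σ : Type*}

/-- **THE `m₀`-SUMMAND OF `hDslot` BY LEVEL.**  In the ONE CALL's indexing (run `r : Bool`, comparison `K`, slot `s`, slot lattice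
`(P r K s, jl r K s)`, slot level `lvl r K s`, chart `e r K s : ↥(Λ r K s) × Fin 3 ≃ Fin (m₀ r K s)`): if every slot's chart sits
in a box of ITS OWN lattice whose side `Ms r (lvl r K s)` is a function of the run and the LEVEL only, and the dimension is at most
`d`, then `(m₀ r K s : ℝ) ≤ 3·d·(Ms r (lvl r K s) + 1)^d` — a LEVEL profile, the shape `hDslot`'s right side `D r (lvl r K s)`
accepts. [folklore] -/
theorem hDslot_dim_of_box (Pf : Bool → ℕ → σ → Params) (jl lvl : Bool → ℕ → σ → ℕ)
    (Λ : ∀ r K s, Finset (PBond (Pf r K s) (jl r K s))) {m₀ : Bool → ℕ → σ → ℕ}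
    (e : ∀ r K s, ↥(Λ r K s) × Fin 3 ≃ Fin (m₀ r K s)) {d : ℕ} (hd : ∀ r K s, (Pf r K s).d ≤ d)
    (lo hi : ∀ r K s, Fin (Pf r K s).d → ℤ) (Ms : Bool → ℕ → ℕ) (hside : ∀ r K s κ, hi r K s κ = lo r K s κ + Ms r (lvl r K s))
    (hΛbox : ∀ r K s, ∀ b ∈ Λ r K s, b ∈ boxBonds (lo r K s) (hi r K s)) (r : Bool) (K : ℕ) (s : σ) :
    (m₀ r K s : ℝ) ≤ 3 * (d : ℝ) * ((Ms r (lvl r K s) : ℝ) + 1) ^ d := by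
  have h := m₀_le_of_box_real (lo r K s) (hi r K s) (hside r K s) (Λ r K s) (hΛbox r K s) (e r K s)
  refine h.trans ?_
  have h1 : (1 : ℝ) ≤ (Ms r (lvl r K s) : ℝ) + 1 := le_add_of_nonneg_left (Nat.cast_nonneg _)
  have hdR : ((Pf r K s).d : ℝ) ≤ d := by exact_mod_cast hd r K s
  calc 3 * ((Pf r K s).d : ℝ) * ((Ms r (lvl r K s) : ℝ) + 1) ^ (Pf r K s).d
      ≤ 3 * (d : ℝ) * ((Ms r (lvl r K s) : ℝ) + 1) ^ (Pf r K s).d := by gcongr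
    _ ≤ 3 * (d : ℝ) * ((Ms r (lvl r K s) : ℝ) + 1) ^ d :=
        mul_le_mul_of_nonneg_left (pow_le_pow_right₀ h1 (hd r K s)) (by positivity)

/-- **… AND BY ONE REAL UNDER A DISPLAYED CAP OF THE SIDE PROFILE** (the `m₀` part of the cap `hDbar : D r j ≤ D̄`): if moreover
`hMs : Ms r j ≤ M̄` for every run and level, then `(m₀ r K s : ℝ) ≤ 3·d·(M̄ + 1)^d` for EVERY slot of EVERY comparison of EITHER
run.  `hMs` is a DISPLAYED hypothesis on a LEVEL profile, NOT a constant of `d, L`: in the designed reading `Ms r j` is the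
`L·M₂·R_j`-TYPE cube side of [Balaban1988Convergent] (2.17) with `R_j ≳ (log g_j^{−2})^p` COUPLING-DEPENDENT ((2.5)), so the
cap is inhabited on the live window under the IR pin of the couplings (WALL COUPLING paragraph; owner R-ne7cp1-g35-2 (c)) —
asserted by nobody here. [folklore] -/
theorem hDbar_dim_of_box (Pf : Bool → ℕ → σ → Params) (jl lvl : Bool → ℕ → σ → ℕ)
    (Λ : ∀ r K s, Finset (PBond (Pf r K s) (jl r K s))) {m₀ : Bool → ℕ → σ → ℕ}
    (e : ∀ r K s, ↥(Λ r K s) × Fin 3 ≃ Fin (m₀ r K s)) {d : ℕ} (hd : ∀ r K s, (Pf r K s).d ≤ d)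
    (lo hi : ∀ r K s, Fin (Pf r K s).d → ℤ) (Ms : Bool → ℕ → ℕ) (hside : ∀ r K s κ, hi r K s κ = lo r K s κ + Ms r (lvl r K s))
    (hΛbox : ∀ r K s, ∀ b ∈ Λ r K s, b ∈ boxBonds (lo r K s) (hi r K s)) {Mbar : ℕ} (hMs : ∀ r j, Ms r j ≤ Mbar)
    (r : Bool) (K : ℕ) (s : σ) : (m₀ r K s : ℝ) ≤ 3 * (d : ℝ) * ((Mbar : ℝ) + 1) ^ d := by
  refine (hDslot_dim_of_box Pf jl lvl Λ e hd lo hi Ms hside hΛbox r K s).trans ?_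
  have : (Ms r (lvl r K s) : ℝ) + 1 ≤ (Mbar : ℝ) + 1 := by gcongr; exact_mod_cast hMs r (lvl r K s)
  gcongr

/-- **`hDslot` FROM LEVEL PROFILES** (the junction, pure arithmetic): if the dimension and the rest of the slot constant are
each dominated by a LEVEL profile — `m₀ r K s ≤ Mdim r (lvl r K s)` (e.g. `hDslot_dim_of_box`) and `rest r K s ≤ R̄ r (lvl r K s)`
— then S95's slot→level majorant holds with `D r j := 2(Mdim r j + R̄ r j)∕(1 − δ)`:
`2(m₀ r K s + rest r K s)∕(1−δ) ≤ D r (lvl r K s)` for every slot. [folklore] -/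
theorem hDslot_of_levelProfiles (lvl : Bool → ℕ → σ → ℕ) {m₀ : Bool → ℕ → σ → ℕ} {rest : Bool → ℕ → σ → ℝ}
    {Mdim Rbar : Bool → ℕ → ℝ} {δ : ℝ} (hδ1 : δ < 1) (hm : ∀ r K s, (m₀ r K s : ℝ) ≤ Mdim r (lvl r K s))
    (hrest : ∀ r K s, rest r K s ≤ Rbar r (lvl r K s)) (r : Bool) (K : ℕ) (s : σ) :
    2 * ((m₀ r K s : ℝ) + rest r K s) / (1 - δ) ≤ 2 * (Mdim r (lvl r K s) + Rbar r (lvl r K s)) / (1 - δ) := by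
  have h1δ : 0 < 1 - δ := sub_pos.2 hδ1
  exact div_le_div_of_nonneg_right (by linarith [hm r K s, hrest r K s]) h1δ.le

/-- … and the level-free cap (`hDbar`'s shape `D r j ≤ D̄`) from level-free caps of the two profiles. [folklore] -/
theorem hDbar_of_caps {Mdim Rbar : Bool → ℕ → ℝ} {Mcap Rcap δ : ℝ} (hδ1 : δ < 1) (hM : ∀ r j, Mdim r j ≤ Mcap)
    (hR : ∀ r j, Rbar r j ≤ Rcap) (r : Bool) (j : ℕ) :
    2 * (Mdim r j + Rbar r j) / (1 - δ) ≤ 2 * (Mcap + Rcap) / (1 - δ) := by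
  have h1δ : 0 < 1 - δ := sub_pos.2 hδ1
  exact div_le_div_of_nonneg_right (by linarith [hM r j, hR r j]) h1δ.le

end OneCall

/-! ## §4 Numbers -/

/-- `d = 4`: the cap is `12·(M+1)^4`. [folklore] -/
example (M : ℕ) : 3 * (4 * (M + 1) ^ 4) = 12 * (M + 1) ^ 4 := by ring

/-- S89's side-2 box on `toyParams` (`d = 2`, `hi = lo + 2`): `#box = 2·2·3 = 12` (§2b), cap `#Λ ≤ 2·3² = 18` (§2); designed block
(comb `3² − 1 = 8` removed): `4` bonds, `m₀ = 12`. [folklore] -/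
example : 2 * (2 * (2 + 1) ^ (2 - 1)) = 12 ∧ 2 * (2 + 1) ^ 2 = 18 ∧ 12 - ((2 + 1) ^ 2 - 1) = 4 ∧ 3 * 4 = 12 := by norm_num

/-- a side-2 box (`hi = lo + 2`, three sites per direction) at `d = 4`: `#box = 4·2·3³ = 216` (§2b), cap `#Λ ≤ 4·3⁴ = 324` (§2),
`m₀ ≤ 972`; designed block (comb `3⁴ − 1 = 80` removed): `136` bonds, `m₀ = 408`. [folklore] -/
example : 4 * (2 * (2 + 1) ^ (4 - 1)) = 216 ∧ 4 * (2 + 1) ^ 4 = 324 ∧ 3 * (4 * (2 + 1) ^ 4) = 972 ∧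
    216 - ((2 + 1) ^ 4 - 1) = 136 ∧ 3 * 136 = 408 := by norm_num

/-- a cube of side `13` at `d = 4` (print's smallest odd `L > 11` times `M₂R_j ≥ 1`): `#box = 4·13·14³ = 142 688`, cap
`m₀ ≤ 12·14⁴ = 460 992`; designed block `142 688 − (14⁴ − 1) = 104 273` bonds, `m₀ = 312 819`. [folklore] -/
example : 4 * (13 * (13 + 1) ^ (4 - 1)) = 142688 ∧ 3 * (4 * (13 + 1) ^ 4) = 460992 ∧
    142688 - ((13 + 1) ^ 4 - 1) = 104273 ∧ 3 * 104273 = 312819 := by norm_num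

/-- the non-vacuity threshold `D·ρ < 1` with `D ≥ 2m₀` (`δ ≥ 0`): on the `d = 4` side-2 block `ρ < 1∕816 < 1.3·10⁻³`, at side `13`
`ρ < 1∕625 638 < 1.6·10⁻⁶`. [folklore] -/
example : 2 * 408 = 816 ∧ 2 * 312819 = 625638 ∧ (1 : ℚ) / 625638 < 1.6e-6 ∧ (1 : ℚ) / 816 < 1.3e-3 := by norm_num

end Summit.QuantumFields.BalabanUV.T4Continuum.ShellMeasureSlotDimension
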